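import Summits.Schanuel.Schanuel.Theorems.RootDecomp1JFirstFailure

/-!
# First failures are blocks — part 2: the bottom of the flag and RANK ESCALATION (supports `stmt-Schanuel-30523`)

Continuation of `RootDecomp1JFirstFailure` (lens 3, NODE v11 §34 of the decomposition cell `decomp-schanuel`; split at §4 for the
400-line rule, same namespace): §4 at the bottom of the flag Schanuel's conjecture `⟺` every `ℚ`-free hereditary block over `ℚ` is
GENERIC (`schanuel_iff_blocks_generic`); §5 RANK ESCALATION over a relatively algebraically closed base (`RelAlgClosed`,
`exists_pow_free`, `relAt_of_relAt_succ`, `forall_relOnRank_iff_relAt_ge`; for the item `pK3_iff_rank_ge (M₀) :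
SchanuelOverPairClosedFields ↔ K₃[rank ≥ M₀]`, `pK2_iff_rank_ge`, `pG2_iff_rank_ge`). Nothing here proves Schanuel or K₃.
-/

set_option linter.dupNamespace false

noncomputable section

open Complex IntermediateField
open Literature.Barriers.Schanuel (trdeg_mono)
open Summit.Schanuel.Schanuel.Theorems.RootDecomp1DFlagSplit (trdeg_adjoin_union_eq_add
  trdeg_adjoin_le_cardinalMk trdeg_gens_lt_aleph0 rel_iff_add disjoint_span_of_linearIndependent_mkQ
  schanuelOn_of_relOn)
open Summit.Schanuel.Schanuel.Theorems.RootDecomp1JKhovanskiiBlocks (mem_and_isAlgebraic_exp_of_mem_span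
  mem_and_isAlgebraic_exp_of_mem_span_set reltrdeg_le_of_isAlgebraic trdeg_witnessField_lt_aleph0)
open Summit.Schanuel.Schanuel.Theorems.RootDecomp1JBlockHulls
open Summit.Schanuel.Schanuel.Theorems.RootDecomp1JGapLemma
open Summit.Schanuel.Schanuel.Theorems.RootDecomp1JRankKernel
open Summit.Schanuel.Schanuel.Theses.RootDecomp1J

namespace Summit.Schanuel.Schanuel.Theorems.RootDecomp1JFirstFailure

set_option synthInstance.maxHeartbeats 400000 in
/-- (private copy, as in `RootDecomp1JGapLemma`; landed public twin
`Literature.Barriers.Schanuel.trdeg_adjoin_union_eq_of_isAlgebraic_adjoin` in NesterenkoModularScopeConjectureProofs,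
not in this import cone) `trdeg_K K(S ∪ T) = trdeg_K K(S)` when `T` is algebraic over `K(S)`. [folklore] -/
private theorem trdeg_adjoin_union_eq_of_isAlgebraic {K E : Type*} [Field K] [Field E] [Algebra K E]
    (S T : Set E) (hT : ∀ x ∈ T, IsAlgebraic (adjoin K S) x) :
    Algebra.trdeg K (adjoin K (S ∪ T)) = Algebra.trdeg K (adjoin K S) := by
  have htower := trdeg_add_eq K (adjoin K S) (A := adjoin (adjoin K S) T)
  have heq : Algebra.trdeg K (adjoin (adjoin K S) T) = Algebra.trdeg K (adjoin K (S ∪ T)) := by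
    rw [← (equivOfEq (adjoin_adjoin_left K S T)).trdeg_eq]
    rfl
  haveI : Algebra.IsAlgebraic (adjoin K S) (adjoin (adjoin K S) T) :=
    IntermediateField.isAlgebraic_adjoin fun x hx => (hT x hx).isIntegral
  have h0 : Algebra.trdeg (adjoin K S) (adjoin (adjoin K S) T) = 0 := trdeg_eq_zero
  rw [h0, add_zero, heq] at htower
  exact htower.symm

/-! ### §4 At the bottom of the flag: Schanuel `↔` hereditary blocks over `ℚ` are generic -/

/-- `Schanuel ↔ ∀ M, Rel(⊤|⊥)[rank ≤ M]` (the base `y ⊂ ⊥` is zero, its field is `ℚ`). -/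
theorem schanuel_iff_forall_relOnRank_bot :
    _root_.Schanuel ↔ ∀ M, RelOnRank (⊥ : Submodule ℚ ℂ) ⊤ M := by
  constructor
  · intro h M k m y z _ hy _ hli
    have hz : LinearIndependent ℚ z := LinearIndependent.of_comp _ hli
    have hS : (m : Cardinal) ≤ Algebra.trdeg ℚ ↥(adjoin ℚ (Set.range z ∪ Set.range (cexp ∘ z))) := h m z hz
    have hfin := trdeg_gens_lt_aleph0 y
    refine (rel_iff_add _ _ hfin m).mpr ?_
    calc Algebra.trdeg ℚ ↥(adjoin ℚ (Set.range y ∪ Set.range (cexp ∘ y))) + (m : Cardinal)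
        = (m : Cardinal) := by rw [trdeg_gens_eq_zero_of_mem_bot hy, zero_add]
      _ ≤ Algebra.trdeg ℚ ↥(adjoin ℚ (Set.range z ∪ Set.range (cexp ∘ z))) := hS
      _ ≤ Algebra.trdeg ℚ ↥(adjoin ℚ ((Set.range y ∪ Set.range (cexp ∘ y)) ∪
            (Set.range z ∪ Set.range (cexp ∘ z)))) := trdeg_mono (adjoin.mono _ _ _ Set.subset_union_right)
  · intro h n z hli
    have hli' : LinearIndependent ℚ ((⊥ : Submodule ℚ ℂ).mkQ ∘ z) := hli.map' _ (Submodule.ker_mkQ ⊥)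
    have H := h n 0 n (![] : Fin 0 → ℂ) z le_rfl (fun i => Fin.elim0 i) (fun _ => Submodule.mem_top) hli'
    have hfin := trdeg_gens_lt_aleph0 (![] : Fin 0 → ℂ)
    have H2 := (rel_iff_add _ _ hfin n).mp H
    have hsub : (Set.range (![] : Fin 0 → ℂ) ∪ Set.range (cexp ∘ (![] : Fin 0 → ℂ))) ∪
        (Set.range z ∪ Set.range (cexp ∘ z)) ⊆ Set.range z ∪ Set.range (cexp ∘ z) := by
      rintro x ((⟨i, -⟩ | ⟨i, -⟩) | hx)
      · exact Fin.elim0 i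
      · exact Fin.elim0 i
      · exact hx
    exact le_add_self.trans (H2.trans (trdeg_mono (adjoin.mono _ _ _ hsub)))

/-- `Schanuel ↔ BlockExactOn ⊥ ⊤`. -/
theorem schanuel_iff_blockExactOn_bot : _root_.Schanuel ↔ BlockExactOn (⊥ : Submodule ℚ ℂ) ⊤ :=
  schanuel_iff_forall_relOnRank_bot.trans (forall_relOnRank_iff_blockExactOn _ _)

/-- A hereditary block over `⊥` is an UPPER-Schanuel tuple: `trdeg ℚ(w, e^w) ≤ |w|`. -/
theorem hblock_bot_trdeg_le {n : ℕ} {w : Fin n → ℂ} (hw : HBlock ⊥ w) :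
    Algebra.trdeg ℚ ↥(adjoin ℚ (Set.range w ∪ Set.range (cexp ∘ w))) ≤ (n : Cardinal) := by
  obtain ⟨Y, hY, hB⟩ := hw
  have h := hB Y le_rfl n id (fun j => Submodule.subset_span (Or.inr ⟨j, rfl⟩))
  have hfin := trdeg_witnessField_lt_aleph0 Y
  have h2 := (rel_le_iff_add _ _ hfin n).mp h
  rw [trdeg_witnessField_eq_zero_of_subset_bot hY, zero_add] at h2
  exact (trdeg_mono (adjoin.mono _ _ _ Set.subset_union_right)).trans h2

/-- **SCHANUEL ⟺ HEREDITARY BLOCKS OVER `ℚ` ARE GENERIC.** Schanuel's conjecture holds iff every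
`ℚ`-linearly independent hereditary block `w` over `⊥` has `trdeg ℚ(w, e^w) = |w|` EXACTLY (blocks have `≤`;
by `RootDecomp1JKhovanskiiBlocks.hblock_of_khovanskii` every `ℚ`-free non-degenerate zero of a square
exponential-polynomial system over `ℤ` is such a block). -/
theorem schanuel_iff_blocks_generic :
    _root_.Schanuel ↔ ∀ (n : ℕ) (w : Fin n → ℂ), HBlock ⊥ w → LinearIndependent ℚ w →
      Algebra.trdeg ℚ ↥(adjoin ℚ (Set.range w ∪ Set.range (cexp ∘ w))) = n := by
  constructor
  · exact fun h n w hB hw => le_antisymm (hblock_bot_trdeg_le hB) (h n w hw)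
  · intro h
    refine schanuel_iff_blockExactOn_bot.mpr fun n w _ hB hw k y hy => ?_
    have hgen := h n w hB (LinearIndependent.of_comp _ hw)
    have hfin := trdeg_gens_lt_aleph0 y
    refine (rel_iff_add _ _ hfin n).mpr ?_
    have hy0 : Algebra.trdeg ℚ ↥(adjoin ℚ (Set.range y ∪ Set.range (cexp ∘ y))) = 0 :=
      trdeg_gens_eq_zero_of_mem_bot hy
    have halg : ∀ x ∈ Set.range y ∪ Set.range (cexp ∘ y),
        IsAlgebraic (adjoin ℚ (Set.range w ∪ Set.range (cexp ∘ w))) x := by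
      rintro x (⟨i, rfl⟩ | ⟨i, rfl⟩)
      · rw [show y i = 0 from (Submodule.mem_bot ℚ).mp (hy i)]; exact isAlgebraic_zero
      · rw [Function.comp_apply, show y i = 0 from (Submodule.mem_bot ℚ).mp (hy i), Complex.exp_zero]
        exact isAlgebraic_one
    calc Algebra.trdeg ℚ ↥(adjoin ℚ (Set.range y ∪ Set.range (cexp ∘ y))) + (n : Cardinal)
        = Algebra.trdeg ℚ ↥(adjoin ℚ (Set.range w ∪ Set.range (cexp ∘ w))) := by rw [hy0, zero_add, hgen]
      _ = Algebra.trdeg ℚ ↥(adjoin ℚ ((Set.range w ∪ Set.range (cexp ∘ w)) ∪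
            (Set.range y ∪ Set.range (cexp ∘ y)))) := (trdeg_adjoin_union_eq_of_isAlgebraic _ _ halg).symm
      _ ≤ Algebra.trdeg ℚ ↥(adjoin ℚ ((Set.range y ∪ Set.range (cexp ∘ y)) ∪
            (Set.range w ∪ Set.range (cexp ∘ w)))) := le_of_eq (by rw [Set.union_comm])

/-! ### §5 Rank escalation: over a relatively algebraically closed base the rank axis is a truncation -/

/-- `RelAlgClosed E`: anything algebraic over an `E`-field `ℚ(Y, e^Y)` (`Y ⊂ E` finite) lies in `E`. -/
def RelAlgClosed (E : Submodule ℚ ℂ) : Prop :=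
  ∀ (Y : Finset ℂ) (g : ℂ), (↑Y : Set ℂ) ⊆ (E : Set ℂ) →
    IsAlgebraic (adjoin ℚ ((↑Y : Set ℂ) ∪ cexp '' ↑Y)) g → g ∈ E

/-- Relative algebraic closedness of every block hull `𝓚_N(E)`, `N ≥ 1`: an element algebraic over a
`𝓚_N(E)`-field is a curve point (a `1`-block) over `𝓚_N(E)`. -/
theorem mem_blockHull_of_isAlgebraic {N : ℕ} (hN : 1 ≤ N) {E : Submodule ℚ ℂ} {g : ℂ} (Y : Finset ℂ)
    (hY : (↑Y : Set ℂ) ⊆ (blockHull N E : Set ℂ))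
    (hg : IsAlgebraic (adjoin ℚ ((↑Y : Set ℂ) ∪ cexp '' ↑Y)) g) : g ∈ blockHull N E := by
  have h1 : g ∈ curveStep (blockHull N E) :=
    mem_curveStep_of_onCurve ⟨Y, hY, reltrdeg_pair_le_one_of_isAlgebraic _ hg⟩
  have h1' : g ∈ blockStep 1 (blockHull N E) := by rw [blockStep_one]; exact h1
  exact (blockStep_blockHull N E).le (blockStep_mono_size hN _ h1')

/-- Every block hull `𝓚_N(E)`, `N ≥ 1`, is relatively algebraically closed. -/
theorem relAlgClosed_blockHull {N : ℕ} (hN : 1 ≤ N) (E : Submodule ℚ ℂ) :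
    RelAlgClosed (blockHull N E) := fun Y _ hY hg => mem_blockHull_of_isAlgebraic hN Y hY hg

/-- Every curve hull `𝓚(E)` is relatively algebraically closed. -/
theorem relAlgClosed_curveHull (E : Submodule ℚ ℂ) : RelAlgClosed (curveHull E) :=
  fun Y _ hY hg => mem_curveHull_of_onCurve ⟨Y, hY, reltrdeg_pair_le_one_of_isAlgebraic _ hg⟩

/-- A relatively algebraically closed subspace is closed under powers. -/
theorem RelAlgClosed.pow_mem {E : Submodule ℚ ℂ} (hE : RelAlgClosed E) {x : ℂ} (hx : x ∈ E) (p : ℕ) :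
    x ^ p ∈ E := by
  classical
  refine hE {x} (x ^ p) (by simpa using hx) ?_
  have hxF : x ∈ adjoin ℚ ((↑({x} : Finset ℂ) : Set ℂ) ∪ cexp '' ↑({x} : Finset ℂ)) :=
    subset_adjoin _ _ (Or.inl (by simp))
  exact isAlgebraic_algebraMap
    (⟨x ^ p, _root_.pow_mem hxF p⟩ : ↥(adjoin ℚ ((↑({x} : Finset ℂ) : Set ℂ) ∪ cexp '' ↑({x} : Finset ℂ))))

/-- `RelAt E E'' M`: every instance of `Rel(E''|E)` of rank EXACTLY `M` holds. -/
def RelAt (E E'' : Submodule ℚ ℂ) (M : ℕ) : Prop :=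
  ∀ (k : ℕ) (y : Fin k → ℂ) (z : Fin M → ℂ), (∀ i, y i ∈ E) → (∀ j, z j ∈ E'') →
    LinearIndependent ℚ (E.mkQ ∘ z) →
    (M : Cardinal) ≤ Algebra.trdeg ↥(adjoin ℚ (Set.range y ∪ Set.range (cexp ∘ y)))
      ↥(adjoin ↥(adjoin ℚ (Set.range y ∪ Set.range (cexp ∘ y))) (Set.range z ∪ Set.range (cexp ∘ z)))

/-- `Rel(E''|E)` at all ranks ⟺ `RelAt E E'' M` for all `M` (the rank-exact form). -/
theorem forall_relOnRank_iff_forall_relAt (E E'' : Submodule ℚ ℂ) :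
    (∀ M, RelOnRank E E'' M) ↔ ∀ M, RelAt E E'' M :=
  ⟨fun h M k y z hy hz hli => h M k M y z le_rfl hy hz hli,
    fun h _ k m y z _ hy hz hli => h m k y z hy hz hli⟩

/-- Rank `0` is trivial. -/
theorem relAt_zero (E E'' : Submodule ℚ ℂ) : RelAt E E'' 0 := fun k y z _ _ _ => by simp

open Submodule in
/-- **A FREE POWER.** If `E` is relatively algebraically closed and `z̄` is `ℚ`-free modulo `E`, some power
`(z i₀)^p`, `p ≥ 2`, keeps `(z i₀ ^ p, z̄)` free modulo `E`: of the `m + 1` powers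
`(z i₀)^2, …, (z i₀)^{m+2}`, if all lay in the `m`-dimensional quotient `span(z̄) mod E`, two would be
`ℚ`-dependent modulo `E`, making `z i₀` a root of a polynomial `p(X) - e`, `p ∈ ℚ[X]` of degree `≥ 2`,
`e ∈ E` — so `z i₀` would be algebraic over the `E`-field `ℚ(e, e^e)`, i.e. `z i₀ ∈ E`: absurd. -/
theorem exists_pow_free {E : Submodule ℚ ℂ} (hE : RelAlgClosed E) {m : ℕ} {z : Fin m → ℂ}
    (hz : LinearIndependent ℚ (E.mkQ ∘ z)) (i₀ : Fin m) :
    ∃ p : ℕ, 2 ≤ p ∧ LinearIndependent ℚ (E.mkQ ∘ Fin.cons (z i₀ ^ p) z) := by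
  classical
  by_contra hcon
  push Not at hcon
  set W : Submodule ℚ (ℂ ⧸ E) := span ℚ (Set.range (E.mkQ ∘ z)) with hW
  have hmemW : ∀ j : Fin (m + 1), E.mkQ (z i₀ ^ ((j : ℕ) + 2)) ∈ W := by
    intro j
    by_contra hnot
    refine hcon ((j : ℕ) + 2) (by omega) ?_
    rw [Fin.comp_cons]
    exact linearIndependent_finCons.mpr ⟨hz, hnot⟩
  haveI : FiniteDimensional ℚ W := FiniteDimensional.span_of_finite ℚ (Set.finite_range _)
  have hWm : Module.finrank ℚ W ≤ m := by
    have h : Module.finrank ℚ W ≤ Fintype.card (Fin m) := by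
      rw [hW]; exact finrank_range_le_card (E.mkQ ∘ z)
    rwa [Fintype.card_fin] at h
  let u : Fin (m + 1) → W := fun j => ⟨E.mkQ (z i₀ ^ ((j : ℕ) + 2)), hmemW j⟩
  have hnot : ¬ LinearIndependent ℚ u := by
    intro hli
    have h : Fintype.card (Fin (m + 1)) ≤ Module.finrank ℚ W := hli.fintype_card_le_finrank
    rw [Fintype.card_fin] at h
    exact Nat.not_succ_le_self m (h.trans hWm)
  obtain ⟨c, hc0, j₀, hj₀⟩ := Fintype.not_linearIndependent_iff.mp hnot
  -- the polynomial `p = Σ c_j X^{j+2} ∈ ℚ[X]` and the relation `p(z i₀) = e ∈ E`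
  set p : Polynomial ℚ := ∑ j : Fin (m + 1), Polynomial.C (c j) * Polynomial.X ^ ((j : ℕ) + 2) with hp
  set e : ℂ := Polynomial.aeval (z i₀) p with he_def
  have he_sum : e = ∑ j : Fin (m + 1), c j • z i₀ ^ ((j : ℕ) + 2) := by
    rw [he_def, hp, map_sum]
    refine Finset.sum_congr rfl fun j _ => ?_
    rw [map_mul, Polynomial.aeval_C, map_pow, Polynomial.aeval_X, Algebra.smul_def]
  have he : e ∈ E := by
    have h1 : (∑ j, c j • u j : W).1 = E.mkQ e := by
      rw [he_sum, map_sum]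
      simp only [AddSubmonoidClass.coe_finsetSum, SetLike.val_smul, map_smul, u]
    have h2 : E.mkQ e = 0 := by rw [← h1, hc0]; rfl
    exact (Submodule.Quotient.mk_eq_zero E).mp h2
  have hcoeff : p.coeff ((j₀ : ℕ) + 2) = c j₀ := by
    rw [hp, Polynomial.finsetSum_coeff, Finset.sum_eq_single j₀]
    · rw [Polynomial.coeff_C_mul_X_pow, if_pos rfl]
    · intro j _ hj
      rw [Polynomial.coeff_C_mul_X_pow, if_neg]
      intro h
      exact hj (Fin.ext (by omega))
    · intro h; exact absurd (Finset.mem_univ j₀) h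
  have hdeg : 2 ≤ p.natDegree := by
    have h : (j₀ : ℕ) + 2 ≤ p.natDegree := Polynomial.le_natDegree_of_ne_zero (by rw [hcoeff]; exact hj₀)
    omega
  -- `z i₀` is algebraic over `ℚ(e, e^e)`
  set F : IntermediateField ℚ ℂ :=
    adjoin ℚ ((↑({e} : Finset ℂ) : Set ℂ) ∪ cexp '' ↑({e} : Finset ℂ)) with hF
  have heF : e ∈ F := subset_adjoin _ _ (Or.inl (by simp))
  have halg : IsAlgebraic F (z i₀) := by
    refine ⟨p.map (algebraMap ℚ F) - Polynomial.C ⟨e, heF⟩, ?_, ?_⟩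
    · intro h0
      have h1 : (p.map (algebraMap ℚ F)).natDegree = (Polynomial.C (⟨e, heF⟩ : F)).natDegree := by
        rw [sub_eq_zero.mp h0]
      rw [Polynomial.natDegree_map_eq_of_injective (algebraMap ℚ F).injective,
        Polynomial.natDegree_C] at h1
      omega
    · rw [map_sub, Polynomial.aeval_map_algebraMap, Polynomial.aeval_C, ← he_def]
      exact sub_self _
  have hz0E : z i₀ ∈ E := hE {e} (z i₀) (by simpa using he) halg
  exact hz.ne_zero i₀ (by
    rw [Function.comp_apply]
    exact (Submodule.Quotient.mk_eq_zero E).mpr hz0E)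

/-- Padding a tuple by a power of one of its coordinates raises `trdeg ℚ(y, z, e^y, e^z)` by at most one.
[folklore] -/
theorem trdeg_cons_pow_le {k m : ℕ} (y : Fin k → ℂ) (z : Fin m → ℂ) (i₀ : Fin m) (p : ℕ) :
    Algebra.trdeg ℚ ↥(adjoin ℚ ((Set.range y ∪ Set.range (cexp ∘ y)) ∪
        (Set.range (Fin.cons (z i₀ ^ p) z : Fin (m + 1) → ℂ) ∪
          Set.range (cexp ∘ (Fin.cons (z i₀ ^ p) z : Fin (m + 1) → ℂ))))) ≤
      Algebra.trdeg ℚ ↥(adjoin ℚ ((Set.range y ∪ Set.range (cexp ∘ y)) ∪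
        (Set.range z ∪ Set.range (cexp ∘ z)))) + 1 := by
  set g : ℂ := z i₀ ^ p with hg
  set A : Set ℂ := (Set.range y ∪ Set.range (cexp ∘ y)) ∪ (Set.range z ∪ Set.range (cexp ∘ z)) with hA
  have hset : (Set.range y ∪ Set.range (cexp ∘ y)) ∪
      (Set.range (Fin.cons g z : Fin (m + 1) → ℂ) ∪ Set.range (cexp ∘ (Fin.cons g z : Fin (m + 1) → ℂ))) =
      (A ∪ {g}) ∪ {cexp g} := by
    rw [Fin.comp_cons, Fin.range_cons, Fin.range_cons, hA]
    ext x
    simp only [Set.mem_union, Set.mem_insert_iff, Set.mem_singleton_iff]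
    tauto
  have hgA : IsAlgebraic (adjoin ℚ A) g := by
    have hz0 : z i₀ ∈ adjoin ℚ A := subset_adjoin _ _ (Or.inr (Or.inl ⟨i₀, rfl⟩))
    exact isAlgebraic_algebraMap (⟨g, by rw [hg]; exact pow_mem hz0 p⟩ : ↥(adjoin ℚ A))
  have halg : ∀ x ∈ ({g} : Set ℂ), IsAlgebraic (adjoin ℚ A) x := by
    intro x hx; rw [Set.mem_singleton_iff.mp hx]; exact hgA
  rw [hset]
  calc Algebra.trdeg ℚ ↥(adjoin ℚ ((A ∪ {g}) ∪ {cexp g}))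
      = Algebra.trdeg ℚ ↥(adjoin ℚ (A ∪ {g})) +
          Algebra.trdeg ↥(adjoin ℚ (A ∪ {g})) ↥(adjoin ↥(adjoin ℚ (A ∪ {g})) ({cexp g} : Set ℂ)) :=
        trdeg_adjoin_union_eq_add (K := ℚ) _ _
    _ ≤ Algebra.trdeg ℚ ↥(adjoin ℚ (A ∪ {g})) + 1 := by
        refine add_le_add le_rfl ?_
        calc Algebra.trdeg ↥(adjoin ℚ (A ∪ {g})) ↥(adjoin ↥(adjoin ℚ (A ∪ {g})) ({cexp g} : Set ℂ))
            ≤ Cardinal.mk ({cexp g} : Set ℂ) := trdeg_adjoin_le_cardinalMk _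
          _ = 1 := Cardinal.mk_singleton _
    _ = Algebra.trdeg ℚ ↥(adjoin ℚ A) + 1 := by
        exact congrArg (· + (1 : Cardinal)) (trdeg_adjoin_union_eq_of_isAlgebraic A {g} halg)

/-- **RANK ESCALATION.** Over a relatively algebraically closed `E` and an upper space `E''` closed under
powers, `Rel(E''|E)` at rank `M + 1` implies it at rank `M ≥ 1`: a rank-`M` failure `(y; z̄)` padded by a
free power `(z₀)^p` (`exists_pow_free`; cost `+ ≤ 1`, `trdeg_cons_pow_le`) is a rank-`(M+1)` failure. -/
theorem relAt_of_relAt_succ {E E'' : Submodule ℚ ℂ} (hE : RelAlgClosed E)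
    (hE'' : ∀ x ∈ E'', ∀ p : ℕ, x ^ p ∈ E'') {M : ℕ} (hM : 1 ≤ M) (h : RelAt E E'' (M + 1)) :
    RelAt E E'' M := by
  intro k y z hy hzE hz
  obtain ⟨p, -, hfree⟩ := exists_pow_free hE hz ⟨0, hM⟩
  have hgE : ∀ j, (Fin.cons (z ⟨0, hM⟩ ^ p) z : Fin (M + 1) → ℂ) j ∈ E'' := by
    intro j
    refine Fin.cases ?_ (fun i => ?_) j
    · rw [Fin.cons_zero]; exact hE'' _ (hzE _) p
    · rw [Fin.cons_succ]; exact hzE i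
  have H := h k y (Fin.cons (z ⟨0, hM⟩ ^ p) z) hy hgE hfree
  have hfin := trdeg_gens_lt_aleph0 y
  have H' := (rel_iff_add _ _ hfin (M + 1)).mp H
  have hpad := trdeg_cons_pow_le y z ⟨0, hM⟩ p
  refine (rel_iff_add _ _ hfin M).mpr ((Cardinal.add_nat_le_add_nat_iff 1).mp ?_)
  calc Algebra.trdeg ℚ ↥(adjoin ℚ (Set.range y ∪ Set.range (cexp ∘ y))) + (M : Cardinal) + ((1 : ℕ) : Cardinal)
      = Algebra.trdeg ℚ ↥(adjoin ℚ (Set.range y ∪ Set.range (cexp ∘ y))) + ((M + 1 : ℕ) : Cardinal) := by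
        push_cast; rw [add_assoc]
    _ ≤ _ := H'
    _ ≤ _ := hpad
    _ = Algebra.trdeg ℚ ↥(adjoin ℚ ((Set.range y ∪ Set.range (cexp ∘ y)) ∪
          (Set.range z ∪ Set.range (cexp ∘ z)))) + ((1 : ℕ) : Cardinal) := by rw [Nat.cast_one]

/-- Downward closure of `RelAt` in the rank (down to rank `1`). -/
theorem relAt_of_le {E E'' : Submodule ℚ ℂ} (hE : RelAlgClosed E)
    (hE'' : ∀ x ∈ E'', ∀ p : ℕ, x ^ p ∈ E'') {M M' : ℕ} (hM : 1 ≤ M) (hMM' : M ≤ M')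
    (h : RelAt E E'' M') : RelAt E E'' M := by
  induction M', hMM' using Nat.le_induction with
  | base => exact h
  | succ M' hMM' ih => exact ih (relAt_of_relAt_succ hE hE'' (le_trans hM hMM') h)

/-- **THE RANK AXIS IS A TRUNCATION AXIS.** Over a relatively algebraically closed base and an upper space
closed under powers: `Rel(E''|E) ↔` its instances of rank `≥ M₀` hold — for EVERY `M₀`. -/
theorem forall_relOnRank_iff_relAt_ge {E E'' : Submodule ℚ ℂ} (hE : RelAlgClosed E)
    (hE'' : ∀ x ∈ E'', ∀ p : ℕ, x ^ p ∈ E'') (M₀ : ℕ) :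
    (∀ M, RelOnRank E E'' M) ↔ ∀ M, M₀ ≤ M → RelAt E E'' M := by
  refine ⟨fun h M _ => (forall_relOnRank_iff_forall_relAt E E'').mp h M,
    fun h => (forall_relOnRank_iff_forall_relAt E E'').mpr fun M => ?_⟩
  rcases Nat.eq_zero_or_pos M with rfl | hM
  · exact relAt_zero E E''
  · rcases Nat.lt_or_ge M M₀ with hlt | hle
    · exact relAt_of_le hE hE'' hM hlt.le (h M₀ le_rfl)
    · exact h M hle

/-- `𝓚₂` (literally) is relatively algebraically closed. -/
theorem relAlgClosed_pairHullLit : RelAlgClosed ((⨆ n : ℕ, (fun E : Submodule ℚ ℂ => E ⊔ Submodule.span ℚ {x : ℂ | ∃ N : ℕ, N ≤ 2 ∧ ∃ w : Fin N → ℂ, (∃ Y : Finset ℂ, (↑Y : Set ℂ) ⊆ ↑E ∧ ∀ T : Finset ℂ, Y ⊆ T → ∀ (r : ℕ) (ρ : Fin r → Fin N), (∀ j, w j ∈ Submodule.span ℚ ((↑T : Set ℂ) ∪ Set.range (w ∘ ρ))) → Algebra.trdeg ↥(IntermediateField.adjoin ℚ ((↑T : Set ℂ) ∪ Complex.exp ''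 ↑T)) ↥(IntermediateField.adjoin ↥(IntermediateField.adjoin ℚ ((↑T : Set ℂ) ∪ Complex.exp '' ↑T)) (Set.range w ∪ Set.range (Complex.exp ∘ w))) ≤ r) ∧ x ∈ Set.range w})^[n + 1] (⨆ n : ℕ, (fun E : Submodule ℚ ℂ => E ⊔ Submodule.span ℚ {g : ℂ | ∃ Y : Finset ℂ, (↑Y : Set ℂ) ⊆ ↑E ∧ Algebra.trdeg ↥(IntermediateField.adjoin ℚ ((↑Y : Set ℂ) ∪ Complex.exp '' ↑Y)) ↥(IntermediateField.adjoin ↥(IntermediateField.adjoin ℚ ((↑Y : Set ℂ) ∪ Complex.exp '' ↑Y)) ({g, Complex.exp g} : Set ℂ)) ≤ 1})^[n + 1] (⨆ n : ℕ, (fun E : Submodule ℚ ℂ => (E ⊔ Submodule.span ℚ (Complex.exp '' ↑E)) ⊔ Submodule.span ℚ (Complex.exp ⁻¹' ↑(E ⊔ Submodule.span ℚ (Complex.exp '' ↑E))))^[n + 1] (Submodule.span ℚ ({z : ℂ | IsAlgebraic ℚ z} ∪ {z : ℂ | ∃ β l : ℂ, IsAlgebraic ℚ β ∧ IsAlgebraic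 ℚ (Complex.exp l) ∧ z = β * l})))))) :=
  relAlgClosed_blockHull (N := 2) (by norm_num) ((⨆ n : ℕ, (fun E : Submodule ℚ ℂ => E ⊔ Submodule.span ℚ {g : ℂ | ∃ Y : Finset ℂ, (↑Y : Set ℂ) ⊆ ↑E ∧ Algebra.trdeg ↥(IntermediateField.adjoin ℚ ((↑Y : Set ℂ) ∪ Complex.exp '' ↑Y)) ↥(IntermediateField.adjoin ↥(IntermediateField.adjoin ℚ ((↑Y : Set ℂ) ∪ Complex.exp '' ↑Y)) ({g, Complex.exp g} : Set ℂ)) ≤ 1})^[n + 1] (⨆ n : ℕ, (fun E : Submodule ℚ ℂ => (E ⊔ Submodule.span ℚ (Complex.exp '' ↑E)) ⊔ Submodule.span ℚ (Complex.exp ⁻¹' ↑(E ⊔ Submodule.span ℚ (Complex.exp '' ↑E))))^[n + 1] (Submodule.span ℚ ({z : ℂ | IsAlgebraic ℚ z} ∪ {z : ℂ | ∃ β l : ℂ, IsAlgebraic ℚ β ∧ IsAlgebraic ℚ (Complex.exp l) ∧ z = β * l})))))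

/-- `𝓚` (literally) is relatively algebraically closed. -/
theorem relAlgClosed_curveHullLit : RelAlgClosed ((⨆ n : ℕ, (fun E : Submodule ℚ ℂ => E ⊔ Submodule.span ℚ {g : ℂ | ∃ Y : Finset ℂ, (↑Y : Set ℂ) ⊆ ↑E ∧ Algebra.trdeg ↥(IntermediateField.adjoin ℚ ((↑Y : Set ℂ) ∪ Complex.exp '' ↑Y)) ↥(IntermediateField.adjoin ↥(IntermediateField.adjoin ℚ ((↑Y : Set ℂ) ∪ Complex.exp '' ↑Y)) ({g, Complex.exp g} : Set ℂ)) ≤ 1})^[n + 1] (⨆ n : ℕ, (fun E : Submodule ℚ ℂ => (E ⊔ Submodule.span ℚ (Complex.exp '' ↑E)) ⊔ Submodule.span ℚ (Complex.exp ⁻¹' ↑(E ⊔ Submodule.span ℚ (Complex.exp '' ↑E))))^[n + 1] (Submodule.span ℚ ({z : ℂ | IsAlgebraic ℚ z} ∪ {z : ℂ | ∃ β l : ℂ, IsAlgebraic ℚ β ∧ IsAlgebraic ℚ (Complex.exp l) ∧ z = β * l}))))) :=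
  relAlgClosed_curveHull ((⨆ n : ℕ, (fun E : Submodule ℚ ℂ => (E ⊔ Submodule.span ℚ (Complex.exp '' ↑E)) ⊔ Submodule.span ℚ (Complex.exp ⁻¹' ↑(E ⊔ Submodule.span ℚ (Complex.exp '' ↑E))))^[n + 1] (Submodule.span ℚ ({z : ℂ | IsAlgebraic ℚ z} ∪ {z : ℂ | ∃ β l : ℂ, IsAlgebraic ℚ β ∧ IsAlgebraic ℚ (Complex.exp l) ∧ z = β * l}))))

/-- **`K₃ ↔ K₃[rank ≥ M₀]` for every `M₀`:** the residual of route 1J lives «at infinity» in the rank; with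
`RootDecomp1JRankKernel.pairHull_rank_le_three_lit` (ranks `≤ 3` are theorems) every rank-piece of K₃ is a
theorem or the whole item. -/
theorem pK3_iff_rank_ge (M₀ : ℕ) :
    SchanuelOverPairClosedFields ↔ ∀ M, M₀ ≤ M → RelAt ((⨆ n : ℕ, (fun E : Submodule ℚ ℂ => E ⊔ Submodule.span ℚ {x : ℂ | ∃ N : ℕ, N ≤ 2 ∧ ∃ w : Fin N → ℂ, (∃ Y : Finset ℂ, (↑Y : Set ℂ) ⊆ ↑E ∧ ∀ T : Finset ℂ, Y ⊆ T → ∀ (r : ℕ) (ρ : Fin r → Fin N), (∀ j, w j ∈ Submodule.span ℚ ((↑T : Set ℂ) ∪ Set.range (w ∘ ρ))) → Algebra.trdeg ↥(IntermediateField.adjoin ℚ ((↑T : Set ℂ) ∪ Complex.exp '' ↑T)) ↥(IntermediateField.adjoin ↥(IntermediateField.adjoin ℚ ((↑T : Set ℂ) ∪ Complex.exp '' ↑T)) (Set.range w ∪ Set.range (Complex.exp ∘ w))) ≤ r) ∧ x ∈ Set.range w})^[n + 1] (⨆ n : ℕ, (fun E : Submodule ℚ ℂ => E ⊔ Submodule.span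 ℚ {g : ℂ | ∃ Y : Finset ℂ, (↑Y : Set ℂ) ⊆ ↑E ∧ Algebra.trdeg ↥(IntermediateField.adjoin ℚ ((↑Y : Set ℂ) ∪ Complex.exp '' ↑Y)) ↥(IntermediateField.adjoin ↥(IntermediateField.adjoin ℚ ((↑Y : Set ℂ) ∪ Complex.exp '' ↑Y)) ({g, Complex.exp g} : Set ℂ)) ≤ 1})^[n + 1] (⨆ n : ℕ, (fun E : Submodule ℚ ℂ => (E ⊔ Submodule.span ℚ (Complex.exp '' ↑E)) ⊔ Submodule.span ℚ (Complex.exp ⁻¹' ↑(E ⊔ Submodule.span ℚ (Complex.exp '' ↑E))))^[n + 1] (Submodule.span ℚ ({z : ℂ | IsAlgebraic ℚ z} ∪ {z : ℂ | ∃ β l : ℂ, IsAlgebraic ℚ β ∧ IsAlgebraic ℚ (Complex.exp l) ∧ z = β * l})))))) ⊤ M :=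
  pK3_iff_forall_relOnRank.trans
    (forall_relOnRank_iff_relAt_ge relAlgClosed_pairHullLit (fun _ _ _ => Submodule.mem_top) M₀)

/-- `K₂ ↔ K₂[rank ≥ M₀]` for every `M₀` (`K₂ = SchanuelOverCurveClosedFields` = 29588, the split node). -/
theorem pK2_iff_rank_ge (M₀ : ℕ) :
    SchanuelOverCurveClosedFields ↔ ∀ M, M₀ ≤ M → RelAt ((⨆ n : ℕ, (fun E : Submodule ℚ ℂ => E ⊔ Submodule.span ℚ {g : ℂ | ∃ Y : Finset ℂ, (↑Y : Set ℂ) ⊆ ↑E ∧ Algebra.trdeg ↥(IntermediateField.adjoin ℚ ((↑Y : Set ℂ) ∪ Complex.exp '' ↑Y)) ↥(IntermediateField.adjoin ↥(IntermediateField.adjoin ℚ ((↑Y : Set ℂ) ∪ Complex.exp '' ↑Y)) ({g, Complex.exp g} : Set ℂ)) ≤ 1})^[n + 1] (⨆ n : ℕ, (fun E : Submodule ℚ ℂ => (E ⊔ Submodule.span ℚ (Complex.exp '' ↑E)) ⊔ Submodule.span ℚ (Complex.exp ⁻¹' ↑(E ⊔ Submodule.span ℚ (Complex.exp '' ↑E))))^[n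 + 1] (Submodule.span ℚ ({z : ℂ | IsAlgebraic ℚ z} ∪ {z : ℂ | ∃ β l : ℂ, IsAlgebraic ℚ β ∧ IsAlgebraic ℚ (Complex.exp l) ∧ z = β * l}))))) ⊤ M :=
  Iff.trans
    ⟨fun h _ k m y z _ hy _ hz => h k m y z hy hz,
      fun h k m y z hy hz => h m k m y z le_rfl hy (fun _ => Submodule.mem_top) hz⟩
    (forall_relOnRank_iff_relAt_ge relAlgClosed_curveHullLit (fun _ _ _ => Submodule.mem_top) M₀)

/-- `G₂ ↔ G₂[rank ≥ M₀]` for every `M₀`. -/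
theorem pG2_iff_rank_ge (M₀ : ℕ) :
    PairBlocksOverCurveClosedFields ↔ ∀ M, M₀ ≤ M → RelAt ((⨆ n : ℕ, (fun E : Submodule ℚ ℂ => E ⊔ Submodule.span ℚ {g : ℂ | ∃ Y : Finset ℂ, (↑Y : Set ℂ) ⊆ ↑E ∧ Algebra.trdeg ↥(IntermediateField.adjoin ℚ ((↑Y : Set ℂ) ∪ Complex.exp '' ↑Y)) ↥(IntermediateField.adjoin ↥(IntermediateField.adjoin ℚ ((↑Y : Set ℂ) ∪ Complex.exp '' ↑Y)) ({g, Complex.exp g} : Set ℂ)) ≤ 1})^[n + 1] (⨆ n : ℕ, (fun E : Submodule ℚ ℂ => (E ⊔ Submodule.span ℚ (Complex.exp '' ↑E)) ⊔ Submodule.span ℚ (Complex.exp ⁻¹' ↑(E ⊔ Submodule.span ℚ (Complex.exp '' ↑E))))^[n + 1] (Submodule.span ℚ ({z : ℂ | IsAlgebraic ℚ z} ∪ {z : ℂ | ∃ β l : ℂ, IsAlgebraic ℚ β ∧ IsAlgebraic ℚ (Complex.exp l) ∧ z = β * l}))))) ((⨆ n : ℕ, (fun E : Submodule ℚ ℂ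 => E ⊔ Submodule.span ℚ {x : ℂ | ∃ N : ℕ, N ≤ 2 ∧ ∃ w : Fin N → ℂ, (∃ Y : Finset ℂ, (↑Y : Set ℂ) ⊆ ↑E ∧ ∀ T : Finset ℂ, Y ⊆ T → ∀ (r : ℕ) (ρ : Fin r → Fin N), (∀ j, w j ∈ Submodule.span ℚ ((↑T : Set ℂ) ∪ Set.range (w ∘ ρ))) → Algebra.trdeg ↥(IntermediateField.adjoin ℚ ((↑T : Set ℂ) ∪ Complex.exp '' ↑T)) ↥(IntermediateField.adjoin ↥(IntermediateField.adjoin ℚ ((↑T : Set ℂ) ∪ Complex.exp '' ↑T)) (Set.range w ∪ Set.range (Complex.exp ∘ w))) ≤ r) ∧ x ∈ Set.range w})^[n + 1] (⨆ n : ℕ, (fun E : Submodule ℚ ℂ => E ⊔ Submodule.span ℚ {g : ℂ | ∃ Y : Finset ℂ, (↑Y : Set ℂ) ⊆ ↑E ∧ Algebra.trdeg ↥(IntermediateField.adjoin ℚ ((↑Y : Set ℂ) ∪ Complex.exp '' ↑Y)) ↥(IntermediateField.adjoin ↥(IntermediateField.adjoin ℚ ((↑Y : Set ℂ) ∪ Complex.exp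 '' ↑Y)) ({g, Complex.exp g} : Set ℂ)) ≤ 1})^[n + 1] (⨆ n : ℕ, (fun E : Submodule ℚ ℂ => (E ⊔ Submodule.span ℚ (Complex.exp '' ↑E)) ⊔ Submodule.span ℚ (Complex.exp ⁻¹' ↑(E ⊔ Submodule.span ℚ (Complex.exp '' ↑E))))^[n + 1] (Submodule.span ℚ ({z : ℂ | IsAlgebraic ℚ z} ∪ {z : ℂ | ∃ β l : ℂ, IsAlgebraic ℚ β ∧ IsAlgebraic ℚ (Complex.exp l) ∧ z = β * l})))))) M :=
  pG2_iff_forall_relOnRank.trans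
    (forall_relOnRank_iff_relAt_ge relAlgClosed_curveHullLit (fun _ hx p => relAlgClosed_pairHullLit.pow_mem hx p) M₀)

end Summit.Schanuel.Schanuel.Theorems.RootDecomp1JFirstFailure
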